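import Summits.BirchSwinnertonDyer.Rank1Residual.X2.AnalyticInvariants
import Summits.BirchSwinnertonDyer.Rank1Residual.X2.MainConjectureConverse
import HarnessLib

/-!
# Crux `MazurMCOnCellB` (stmt-BirchSwinnertonDyer-19033), line `mudescent`, stub
# `stub_analyticMuZero_offLocus` — the Mazur–Tate–Teitelbaum function at `p ‖ N` does NOT VANISH at a
# rank-`0` pair, with the explicit constant-term bound `μ_an ≤ ord_p(L(E,1)/Ω_E)` (helper; closes nothing)

Cell `bsd-eis` (HOME `run/shared/lean/pub/bsd-eis/`), D-0154 width seat `bsd-line-x2-p1-w2` (gen 2) on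
crux 3 = row A10 (X2b: `r_an = 0`, odd MULTIPLICATIVE Eisenstein `p`, `¬ GVPar`), skeleton of record
`Cruxes/MazurMCOnCellB/Lines/mudescent.lean` (sha256 `bcae135b…`). The seat's stub is
`stub_analyticMuZero_offLocus : X2.CellB W₀ p → ¬ HasRamifiedOddLineAt W₀ p → X2.AnalyticMuLE W₀ p 0`
(gen 0 verdict of record: `stub-blocked` on `Rank1Residual.GreenbergMuConjecture`, helper p607076).

WHY THIS FILE. The tree types "`μ_an(E,p) ≤ m`" at a multiplicative prime as the FINITE check
`X2.AnalyticMuLE W p m` ("some coefficient of `ϖ·L` has norm `> p^{-(m+1)}`") and every X2 road reads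
the non-vanishing `ϖ·L ≠ 0` of THE Mazur–Tate–Teitelbaum function off such a certificate
(`X2.ne_zero_of_lt_norm_coeff`); but `∃ m, X2.AnalyticMuLE W p m` itself was not a tree theorem —
`Theorems/EisensteinPrimesMazurMCOnCellBCongruenceRoadMuPart.lean` (module docstring, §3): «the
converse decomposition «stub ⟺ (S″) ∧ (μ-part)» of the X1 twin would need the non-vanishing of the
Mazur–Tate–Teitelbaum function, which the tree does not hold as a theorem». At a rank-`0` pair it is
elementary from the INTERPOLATION PROPERTY, and this file records it:

* §1 `zpow_neg_toNat_succ_lt_norm` — bookkeeping: `p^{-(⌈v⌉₊+1)} < ‖x‖` for `x ≠ 0` of valuation `v`.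
* §2 NON-SPLIT `p` (`a_p = −1`, no exceptional zero): the constant term of `ϖ·L` is
  `ϖ·(1 − a_p⁻¹)·[0]⁺_f = 2·L(E,1)/Ω_E` (`IsMultPAdicLFunctionOf.constantCoeff_of_neg_one`,
  `IsNewformOf.entireLFunction_one_eq`), so for `p ≠ 2` and `L(E,1)/Ω_E = t ≠ 0`:
  `X2.AnalyticMuLE W p ⌈ord_p t⌉₊` (`analyticMuLE_of_not_split_of_lvalue_eq`) — in words
  **`μ_an(E,p) ≤ ord_p(L(E,1)/Ω_E) = ord_p(#Ш_an·∏ c_ℓ/#E(ℚ)_tors²)`**, class-wide; in particular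
  `X2.AnalyticMuLE W p 0` — the stub's conclusion — whenever `ord_p(L(E,1)/Ω_E) ≤ 0`
  (`analyticMuLE_zero_of_not_split_of_padicValRat_le_zero`; the per-pair «unit constant term» road,
  here as one theorem for all pairs).
* §3 SPLIT `p` (`a_p = 1`, exceptional zero): `[T¹](ϖ·L)·log_p κ(γ) = 𝓛_p(E)·L(E,1)/Ω_E`
  (Greenberg–Stevens, named fact `greenberg_stevens`, a binder of the route's `PublishedInputs`;
  `𝓛_p(E) ≠ 0`, tree theorem `LInvariant_ne_zero_holds` = Barré-Sirieix–Diaz–Gramain–Philibert;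
  `ord_p log_p κ(γ) = 1`), so `X2.AnalyticMuLE W p ⌈ord_p 𝓛_p(E) + ord_p t − 1⌉₊`
  (`analyticMuLE_of_split_of_lvalue_eq`).
* §4 `exists_analyticMuLE_of_analyticRank_eq_zero` — at EVERY pair `(W, p)`, `p ≠ 2`, with
  `ord_{s=1} L(E,s) = 0` (modularity `hpar` for the entire continuation and the rationality of
  `L(E,1)/Ω_E`; `hGS` at a split prime): `∃ m, X2.AnalyticMuLE W p m`; and the NON-VANISHING
  `C(ϖ)·L ≠ 0`, `L ≠ 0` for every datum of the predicate (`varpi_mul_ne_zero_of_analyticRank_eq_zero`).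

USE (sequel `EisensteinPrimesMazurMCOnCellBMuPartTight.lean`, same seat): with §4 the μ-TOLERANT
route T (`μ-part ∧ λ-count ⇒ X2.MazurMainConjectureAt`) has no certificate input left, the converse of
the λ-count (`EisensteinPrimesAnalyticLambdaCruxSized.exists_lambdaCount_of_mazurMainConjectureAt`)
loses its `hμ` hypothesis on row A10, and stub 3 decomposes at `p ‖ N` exactly as its X1 twin:
`stub 3 at W₀ ⟺ (μ-part at W₀) ∧ (μ(X(W₀/ℚ_∞)) = 0)`.

HONEST FRAMING: bookkeeping on the analytic side of an OPEN crux; nothing here proves Mazur's main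
conjecture, the stub, or BSD for any curve; 0 cells / 0 labels move. No `def`, no new named fact,
no `sorry`; hypotheses are the tree's PUBLISHED named facts by name (`hpar`, `hGS`).

References: [MazurTateTeitelbaum1986] §I.10 (`ε(p) = 0`), §I.14–I.15; [GreenbergLNM1716] §4 (PDF
p. 113: the factor `(1 − α_p⁻¹)`, `l_v = 2` at a non-split prime); [GreenbergStevens1993] Thm. of the
Introduction; [Kobayashi2006DocMath] Cor. 4.2; [BarreSirieixDiazGramainPhilibert1996Manin] Thm. 1;
[GreenbergVatsal2000] p. 2, (1)–(2); HOME `line-x2-p1-w2-g0/STUB-REPORT-analyticMuZero_offLocus.md`.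
-/

set_option autoImplicit false

-- `Summit.BirchSwinnertonDyer.BirchSwinnertonDyer.…`: the summit and its single sub-problem share a name (D-0017 layout).
set_option linter.dupNamespace false

noncomputable section

open scoped Classical MatrixGroups ModularForm

open PowerSeries CongruenceSubgroup WeierstrassCurve
  Literature.NumberTheory.EllipticCurves
  Literature.NumberTheory.EllipticCurves.ModularForms
  Literature.NumberTheory.EllipticCurves.Rank1Residual
  Summit.BirchSwinnertonDyer.Rank1Residual

namespace Summit.BirchSwinnertonDyer.BirchSwinnertonDyer.Theorems.EisensteinPrimesX2AnalyticMuBound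

variable {W : WeierstrassCurve ℚ} [W.IsElliptic] [W.IsGloballyMinimal] {p : ℕ} [Fact p.Prime]

/-! ## §1. Bookkeeping: the certificate exponent from a valuation -/

omit [W.IsElliptic] [W.IsGloballyMinimal] in
/-- For `x ≠ 0` in `ℚ_p` with valuation `v`: `p^{-(⌈v⌉₊ + 1)} < ‖x‖ = p^{-v}` (`⌈v⌉₊ = v.toNat ≥ v`).
This is the shape of the certificate `X2.AnalyticMuLE W p ⌈v⌉₊` read on one coefficient. [folklore] -/
theorem zpow_neg_toNat_succ_lt_norm {x : ℚ_[p]} (hx : x ≠ 0) :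
    (p : ℝ) ^ (-(((x.valuation.toNat : ℕ) : ℤ) + 1)) < ‖x‖ := by
  have hpP : p.Prime := Fact.out
  rw [Padic.norm_eq_zpow_neg_valuation hx]
  have hp1 : (1 : ℝ) < p := by exact_mod_cast hpP.one_lt
  apply zpow_lt_zpow_right₀ hp1
  have := Int.self_le_toNat x.valuation
  omega

omit [W.IsGloballyMinimal] in
/-- The rational number `L(E,1)/Ω_E` is `ϖ·[0]⁺_f` for every newform `f` of `W` and every
Néron-normalising `ϖ` (`ϖ·Ω_E = Ω⁺_f`): `L(E,1) = [0]⁺_f·Ω⁺_f` (`IsNewformOf.entireLFunction_one_eq`).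
[cite: MazurTateTeitelbaum1986, §I.14 (shape)] -/
theorem lvalue_eq_varpi_mul_ratPlusSymbol {N : ℕ} [NeZero N] {f : CuspForm (Gamma0 N) 2}
    (hf : IsNewformOf W f) {ϖ : ℚ} (hϖ : (ϖ : ℝ) * W.realPeriodRat = plusPeriod f) {t : ℚ}
    (ht : W.entireLFunction 1 / (W.realPeriodRat : ℂ) = (t : ℂ)) :
    t = ϖ * ratPlusSymbol f 0 := by
  have hΩpos : 0 < W.realPeriodRat := W.realPeriodRat_pos_holds
  have hLval : W.entireLFunction 1 = ((((ratPlusSymbol f 0 : ℚ) : ℝ) * plusPeriod f : ℝ) : ℂ) :=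
    hf.entireLFunction_one_eq
  have hq : W.entireLFunction 1 / (W.realPeriodRat : ℂ) = (((ϖ * ratPlusSymbol f 0 : ℚ)) : ℂ) := by
    rw [hLval, ← hϖ, div_eq_iff (Complex.ofReal_ne_zero.mpr hΩpos.ne')]
    push_cast
    ring
  rw [ht] at hq
  exact_mod_cast hq

/-! ## §2. Non-split `p`: `μ_an ≤ ord_p(L(E,1)/Ω_E)` -/

/-- **Non-split multiplicative `p ≠ 2`, `L(E,1) ≠ 0`: `μ_an(E,p) ≤ ord_p(L(E,1)/Ω_E)`.** If
`L(E,1)/Ω_E = t ≠ 0` (`t ∈ ℚ`) then `X2.AnalyticMuLE W p ⌈ord_p t⌉₊`: for every newform `f`, every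
`ϖ` with `ϖ·Ω_E = Ω⁺_f` and THE non-split Mazur–Tate–Teitelbaum function `L`
(`IsMultPAdicLFunctionOf f p (−1) L`), the constant coefficient of `ϖ·L` is `ϖ·2·[0]⁺_f = 2t`
(no exceptional zero; `(1 − a_p⁻¹) = 2`, Greenberg LNM 1716 §4), of norm `p^{-ord_p t} > p^{-(⌈ord_p t⌉₊+1)}`.
In BSD currency `t = #Ш_an(E)·∏ c_ℓ/#E(ℚ)_tors²`. [cite: GreenbergLNM1716, §4 (PDF p. 113)]
[cite: MazurTateTeitelbaum1986, §I.10, §I.14] -/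
theorem analyticMuLE_of_not_split_of_lvalue_eq (hp2 : p ≠ 2)
    (hns : ¬ W.HasSplitMultiplicativeReductionAtPrime p) {t : ℚ} (ht0 : t ≠ 0)
    (ht : W.entireLFunction 1 / (W.realPeriodRat : ℂ) = (t : ℂ)) :
    X2.AnalyticMuLE W p (padicValRat p t).toNat := by
  intro N _ f hf ϖ hϖ L _ hLn
  have hLp : IsMultPAdicLFunctionOf f p (-1) L := hLn hns
  have htϖ : t = ϖ * ratPlusSymbol f 0 := lvalue_eq_varpi_mul_ratPlusSymbol hf hϖ ht
  refine ⟨0, ?_⟩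
  have hc0 : PowerSeries.coeff 0 (PowerSeries.C ((ϖ : ℚ) : ℚ_[p]) * L) = 2 * ((t : ℚ) : ℚ_[p]) := by
    rw [PowerSeries.coeff_zero_eq_constantCoeff, map_mul, PowerSeries.constantCoeff_C,
      hLp.constantCoeff_of_neg_one, htϖ]
    push_cast
    ring
  have htQ0 : ((t : ℚ) : ℚ_[p]) ≠ 0 := by exact_mod_cast ht0
  have hx0 : (2 : ℚ_[p]) * ((t : ℚ) : ℚ_[p]) ≠ 0 := mul_ne_zero two_ne_zero htQ0
  have hval : ((2 : ℚ_[p]) * ((t : ℚ) : ℚ_[p])).valuation = padicValRat p t := by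
    rw [Padic.valuation_mul two_ne_zero htQ0, X2.valuation_two_eq_zero hp2, Padic.valuation_ratCast,
      zero_add]
  have key := zpow_neg_toNat_succ_lt_norm hx0
  rw [hval] at key
  rw [hc0]
  exact key

/-- **Non-split `p ≠ 2`, `ord_p(L(E,1)/Ω_E) ≤ 0` ⇒ `μ_an(E,p) = 0`**: the conclusion
`X2.AnalyticMuLE W p 0` of `stub_analyticMuZero_offLocus` at every such pair (the «unit constant
term» road of the cell, one theorem for all pairs; by Wuthrich's integrality the hypothesis means
`p ∤ #Ш_an(E)·∏ c_ℓ/#E(ℚ)_tors²`). [cite: GreenbergLNM1716, §4 (PDF p. 113)] [cite: Wuthrich2014, Cor. 18] -/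
theorem analyticMuLE_zero_of_not_split_of_padicValRat_le_zero (hp2 : p ≠ 2)
    (hns : ¬ W.HasSplitMultiplicativeReductionAtPrime p) {t : ℚ} (ht0 : t ≠ 0)
    (ht : W.entireLFunction 1 / (W.realPeriodRat : ℂ) = (t : ℂ)) (hv : padicValRat p t ≤ 0) :
    X2.AnalyticMuLE W p 0 := by
  intro N _ f hf ϖ hϖ L hLs hLn
  obtain ⟨k, hk⟩ := analyticMuLE_of_not_split_of_lvalue_eq hp2 hns ht0 ht f hf ϖ hϖ L hLs hLn
  refine ⟨k, ?_⟩
  rwa [Int.toNat_eq_zero.mpr hv] at hk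

/-! ## §3. Split `p`: `μ_an ≤ ord_p 𝓛_p(E) + ord_p(L(E,1)/Ω_E) − 1` (Greenberg–Stevens) -/

/-- **Split multiplicative `p ≠ 2`, `L(E,1) ≠ 0`: `μ_an(E,p) ≤ ord_p 𝓛_p(E) + ord_p(L(E,1)/Ω_E) − 1`.**
With the Tate parameter datum `Dq` (so `p` is split), granted Greenberg–Stevens at `(E,p)` (`hGS`,
PUBLISHED: `[T¹]L·log_p κ(γ) = 𝓛_p(E)·[0]⁺_f`): for every datum of the predicate the coefficient of
`T¹` in `ϖ·L` is `𝓛_p(E)·t/log_p κ(γ)`, non-zero (`𝓛_p(E) ≠ 0`, `LInvariant_ne_zero_holds`;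
`ord_p log_p κ(γ) = 1`) of valuation `ord_p 𝓛_p(E) + ord_p t − 1`; hence
`X2.AnalyticMuLE W p ⌈ord_p 𝓛_p(E) + ord_p t − 1⌉₊`. [cite: Kobayashi2006DocMath, Cor. 4.2 (p. 575)]
[cite: BarreSirieixDiazGramainPhilibert1996Manin, Thm. 1] [cite: MazurTateTeitelbaum1986, §I.15] -/
theorem analyticMuLE_of_split_of_lvalue_eq (hp2 : p ≠ 2)
    (hGS : greenberg_stevens (W := W) (p := p)) (Dq : TateParameterData W p) {t : ℚ} (ht0 : t ≠ 0)
    (ht : W.entireLFunction 1 / (W.realPeriodRat : ℂ) = (t : ℂ)) :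
    X2.AnalyticMuLE W p ((LInvariant Dq).valuation + padicValRat p t - 1).toNat := by
  intro N _ f hf ϖ hϖ L hLs _
  have hL : IsSplitMultPAdicLFunctionOf f p L := hLs Dq.split
  have htϖ : t = ϖ * ratPlusSymbol f 0 := lvalue_eq_varpi_mul_ratPlusSymbol hf hϖ ht
  obtain ⟨-, hGS1⟩ := hGS Dq hf hL
  obtain ⟨hlog0, hlogv⟩ := X2.valuation_padicLog_cyclotomicGenerator (p := p) hp2
  have h𝓛0 : LInvariant Dq ≠ 0 := LInvariant_ne_zero_holds Dq
  refine ⟨1, ?_⟩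
  -- the coefficient of `T¹`: `ϖ · [T¹]L = 𝓛 · t / log`
  have hc1 : PowerSeries.coeff 1 (PowerSeries.C ((ϖ : ℚ) : ℚ_[p]) * L) =
      LInvariant Dq * ((t : ℚ) : ℚ_[p]) / padicLog p (cyclotomicGenerator p : ℚ_[p]) := by
    rw [PowerSeries.coeff_C_mul, eq_div_iff hlog0, htϖ]
    push_cast
    linear_combination ((ϖ : ℚ) : ℚ_[p]) * hGS1
  have htQ0 : ((t : ℚ) : ℚ_[p]) ≠ 0 := by exact_mod_cast ht0
  have hnum0 : LInvariant Dq * ((t : ℚ) : ℚ_[p]) ≠ 0 := mul_ne_zero h𝓛0 htQ0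
  have hx0 : LInvariant Dq * ((t : ℚ) : ℚ_[p]) / padicLog p (cyclotomicGenerator p : ℚ_[p]) ≠ 0 :=
    div_ne_zero hnum0 hlog0
  have hval : (LInvariant Dq * ((t : ℚ) : ℚ_[p]) / padicLog p (cyclotomicGenerator p : ℚ_[p])).valuation
      = (LInvariant Dq).valuation + padicValRat p t - 1 := by
    rw [div_eq_mul_inv, Padic.valuation_mul hnum0 (inv_ne_zero hlog0), Padic.valuation_mul h𝓛0 htQ0,
      Padic.valuation_inv, hlogv, Padic.valuation_ratCast]
    ring
  have key := zpow_neg_toNat_succ_lt_norm hx0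
  rw [hval] at key
  rw [hc1]
  exact key

/-! ## §4. Non-vanishing at every rank-`0` pair -/

/-- **At a rank-`0` pair the analytic `μ` is finite: `∃ m, X2.AnalyticMuLE W p m`** (`p ≠ 2`,
`ord_{s=1} L(E,s) = 0`; modularity `hpar` supplies the entire continuation and a newform, hence
`L(E,1) ≠ 0` (`analyticRank_eq_zero_iff_holds`) and `L(E,1)/Ω_E ∈ ℚ`; Greenberg–Stevens `hGS` is used
only at a split prime). The witness is `⌈ord_p(L(E,1)/Ω_E)⌉₊` at a non-split prime and
`⌈ord_p 𝓛_p(E) + ord_p(L(E,1)/Ω_E) − 1⌉₊` at a split prime. [cite: MazurTateTeitelbaum1986, §I.14–I.15]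
[cite: Kobayashi2006DocMath, Cor. 4.2 (p. 575)] -/
theorem exists_analyticMuLE_of_analyticRank_eq_zero (hpar : nonempty_modularParametrizationData)
    (hp2 : p ≠ 2) (hGS : greenberg_stevens (W := W) (p := p)) (hr0 : W.analyticRank = 0) :
    ∃ m : ℕ, X2.AnalyticMuLE W p m := by
  haveI : NeZero (W.conductorNorm ℤ) := ⟨(W.conductorNorm_pos_holds).ne'⟩
  obtain ⟨Dm⟩ := hpar W
  have hf₀ : IsNewformOf W Dm.f := Dm.isNewformOf
  obtain ⟨ϖ₀, -, hϖ₀, -⟩ := Dm.exists_rat_mul_realPeriodRat_eq_plusPeriod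
  have hL1 : W.entireLFunction 1 ≠ 0 := (W.analyticRank_eq_zero_iff_holds hf₀.hasEntireLFunction).mp hr0
  have hΩpos : 0 < W.realPeriodRat := W.realPeriodRat_pos_holds
  -- the rational `t = L(E,1)/Ω_E = ϖ₀ · [0]⁺_{f₀}`
  set t : ℚ := ϖ₀ * ratPlusSymbol Dm.f 0 with ht_def
  have hLval : W.entireLFunction 1 = ((((ratPlusSymbol Dm.f 0 : ℚ) : ℝ) * plusPeriod Dm.f : ℝ) : ℂ) :=
    hf₀.entireLFunction_one_eq
  have ht : W.entireLFunction 1 / (W.realPeriodRat : ℂ) = (t : ℂ) := by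
    rw [hLval, ← hϖ₀, div_eq_iff (Complex.ofReal_ne_zero.mpr hΩpos.ne'), ht_def]
    push_cast
    ring
  have ht0 : t ≠ 0 := by
    intro h0
    apply hL1
    have h := ht
    rw [h0, Rat.cast_zero, div_eq_zero_iff] at h
    rcases h with h | h
    · exact h
    · exact absurd (Complex.ofReal_eq_zero.mp h) hΩpos.ne'
  by_cases hsplit : W.HasSplitMultiplicativeReductionAtPrime p
  · obtain ⟨Dq⟩ := (nonempty_tateParameterData_iff_holds (W := W) (p := p)).mpr hsplit
    exact ⟨_, analyticMuLE_of_split_of_lvalue_eq hp2 hGS Dq ht0 ht⟩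
  · exact ⟨_, analyticMuLE_of_not_split_of_lvalue_eq hp2 hsplit ht0 ht⟩

/-- **Non-vanishing of THE Mazur–Tate–Teitelbaum function at a rank-`0` pair** (`p ≠ 2`): for every
newform `f` of `W`, every Néron-normalising `ϖ` and every `L` as in `X2.AnalyticMuLE` /
`X2.MazurMainConjectureAt` (split: `IsSplitMultPAdicLFunctionOf f p L`; non-split:
`IsMultPAdicLFunctionOf f p (−1) L`): `C(ϖ)·L ≠ 0` and `L ≠ 0`. The statement the tree's congruence-road
file recorded as missing at `p ‖ N`. [cite: MazurTateTeitelbaum1986, §I.14–I.15]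
[cite: Kobayashi2006DocMath, Cor. 4.2 (p. 575)] -/
theorem varpi_mul_ne_zero_of_analyticRank_eq_zero (hpar : nonempty_modularParametrizationData)
    (hp2 : p ≠ 2) (hGS : greenberg_stevens (W := W) (p := p)) (hr0 : W.analyticRank = 0)
    {N : ℕ} [NeZero N] {f : CuspForm (Gamma0 N) 2} (hf : IsNewformOf W f) {ϖ : ℚ}
    (hϖ : (ϖ : ℝ) * W.realPeriodRat = plusPeriod f) {L : PowerSeries ℚ_[p]}
    (hLs : W.HasSplitMultiplicativeReductionAtPrime p → IsSplitMultPAdicLFunctionOf f p L)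
    (hLn : ¬ W.HasSplitMultiplicativeReductionAtPrime p → IsMultPAdicLFunctionOf f p (-1) L) :
    PowerSeries.C ((ϖ : ℚ) : ℚ_[p]) * L ≠ 0 ∧ L ≠ 0 := by
  obtain ⟨m, hμ⟩ := exists_analyticMuLE_of_analyticRank_eq_zero hpar hp2 hGS hr0
  obtain ⟨k, hk⟩ := hμ f hf ϖ hϖ L hLs hLn
  have h1 : PowerSeries.C ((ϖ : ℚ) : ℚ_[p]) * L ≠ 0 := by
    intro h0
    rw [h0, map_zero, norm_zero] at hk
    exact not_le.mpr hk (by positivity)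
  exact ⟨h1, fun h0 ↦ h1 (by rw [h0, mul_zero])⟩

/-- Every `G ∈ Λ` with `ι(G) = ϖ·L` at a rank-`0` pair is non-zero (the integral avatar of
`varpi_mul_ne_zero_of_analyticRank_eq_zero`; e.g. Wuthrich's `T^e·g`, `g ∈ char_Λ X`).
[cite: Wuthrich2014, Thm. 16 (p. 397)] -/
theorem ne_zero_of_iwasawaToPowerSeries_eq_of_analyticRank_eq_zero
    (hpar : nonempty_modularParametrizationData) (hp2 : p ≠ 2)
    (hGS : greenberg_stevens (W := W) (p := p)) (hr0 : W.analyticRank = 0)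
    {N : ℕ} [NeZero N] {f : CuspForm (Gamma0 N) 2} (hf : IsNewformOf W f) {ϖ : ℚ}
    (hϖ : (ϖ : ℝ) * W.realPeriodRat = plusPeriod f) {L : PowerSeries ℚ_[p]}
    (hLs : W.HasSplitMultiplicativeReductionAtPrime p → IsSplitMultPAdicLFunctionOf f p L)
    (hLn : ¬ W.HasSplitMultiplicativeReductionAtPrime p → IsMultPAdicLFunctionOf f p (-1) L)
    {G : IwasawaAlgebra p} (hG : iwasawaToPowerSeries p G = PowerSeries.C ((ϖ : ℚ) : ℚ_[p]) * L) :
    G ≠ 0 := by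
  intro h0
  apply (varpi_mul_ne_zero_of_analyticRank_eq_zero hpar hp2 hGS hr0 hf hϖ hLs hLn).1
  rw [← hG, h0, map_zero]

end Summit.BirchSwinnertonDyer.BirchSwinnertonDyer.Theorems.EisensteinPrimesX2AnalyticMuBound

end
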